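import Mathlib.ModelTheory.Definability
import Mathlib.Analysis.SpecialFunctions.Pow.Real
import Literature.ModelTheory.ExponentialFields.WilkieConjecture
import Literature.ModelTheory.ExponentialFields.ModelTheoryPreds
import HarnessLib

/-!
# The Pila–Wilkie counting theorem (Pila–Wilkie 2006, Theorem 1.8) — named fact

Topic `Literature/ModelTheory/ExponentialFields`, over the tree's vocabulary of
`WilkieConjecture.lean` (`algPart X = X^alg`, `transPart X = X ∖ X^alg`, `ratPointsLE X H = X(ℚ, H)`,
transcribed there from Pila–Wilkie 2006, 1.3/1.5 via Binyamini–Novikov–Zak 2024, §1.1) and the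
tree's o-minimality predicate `FirstOrder.Language.IsOMinimal L ℝ` (`ModelTheoryPreds.lean`,
Pillay–Steinhorn 1986, Def. 1.1: every parametrically definable subset of the line is a finite
union of points and intervals).

Source: J. Pila, A. J. Wilkie, *The rational points of a definable set*, Duke Math. J. 133 (2006),
591–616, doi:10.1215/S0012-7094-06-13336-7 [PilaWilkie2006] (author version dated 2005.10.10,
read: PDF pp. 3–6 = §1, 1.3–1.10). Printed:

* 1.3 (p. 2): *"Let `H : ℚ → ℝ` denote the usual height function: `H(a/b) = max(|a|, b)` where
  `a, b ∈ ℤ, b > 0, gcd(a, b) = 1`. Extend to `H : ℚⁿ → ℝ` by setting `H⟨α₁, …, αₙ⟩ = max(H(αⱼ))`.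
  If `X ⊂ ℝⁿ`, let `X(ℚ)` denote the subset of points with rational coordinates. Set (for `T ≥ 1`)
  `X(ℚ, T) = {P ∈ X(ℚ), H(P) ≤ T}` and define the density function of `X` to be
  `N(X, T) = #X(ℚ, T)`."*
* 1.5 (p. 3): *"Let `X ⊂ ℝⁿ`. The algebraic part of `X`, denoted `X^alg`, is the union of all
  connected semialgebraic subsets of `X` of positive dimension. The transcendental part of `X` is
  the complement `X − X^alg`."*
* 1.7 (p. 4): a *structure (over the real field)* is a sequence `S = (Sₙ)` of boolean algebras of
  subsets of `ℝⁿ` containing every semialgebraic subset of `ℝⁿ`, closed under cartesian products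
  and under the coordinate projections `ℝᵐ → ℝⁿ`; it is *o-minimal* if moreover *"(5) the boundary
  of every set in `S₁` is finite"*; *"Let then `S` be an o-minimal structure (over `ℝ`). A definable
  set `X ⊂ ℝⁿ` will mean a set definable in `S`."*
* **1.8. Theorem (First version)** (p. 5): *"Let `X ⊂ ℝⁿ` be a definable set, and `ε > 0`. There
  is a constant `c(X, ε)` such that `N(X − X^alg, T) ≤ c(X, ε) T^ε`."*

## Contents

* `PilaWilkie2006_thm_1_8` — **named fact** (D-0014): Theorem 1.8 over an arbitrary o-minimal
  expansion of the real field, presented as a first-order language `L` with an `L`-structure on `ℝ`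
  that is o-minimal for the usual order (`L.IsOMinimal ℝ`) and in which the graphs of `+` and `·`
  are definable with parameters (so that every semialgebraic set is definable, 1.7 (2)); for every
  `X ⊆ ℝⁿ` definable with parameters and every `ε > 0` there is `c` with
  `#(X ∖ X^alg)(ℚ, H) ≤ c · H^ε` for all integers `H ≥ 1` (finiteness being part of the count).

Grounds `Summit.Schanuel.Schanuel.Theses.MisiurewiczField.AddressSparsity` (route
MisiurewiczField, item stmt-Schanuel-12574): the sparsity exponent `R^ε` of that item is this
theorem applied to the address-definable sets of the window trick (which live in `ℝ_{an,exp}`,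
o-minimal by van den Dries–Macintyre–Marker 1994 — that o-minimality is NOT recorded here).

## Transcription notes

* "definable in an o-minimal structure over `ℝ`" (1.7) is rendered by quantifying over languages
  `L : Language.{0, 0}` with `[L.Structure ℝ]`, the hypotheses `L.IsOMinimal ℝ` (condition (5):
  a subset of `ℝ` has finite boundary iff it is a finite union of points and intervals) and the
  parametric definability of the graphs of addition and multiplication (condition (2): with these,
  every semialgebraic set — polynomial (in)equalities with real parameters, `p > 0 ↔ ∃ y ≠ 0,
  p = y²` — is `L`-definable with parameters; conditions (1), (3), (4) hold for first-order
  definability automatically). Conversely every structure `S` in the sense of 1.7 is the family of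
  definable sets of the language with one relation symbol per member of `S`, so nothing is lost
  but the universe restriction on `L` (a specialisation, never stronger).
* `T ≥ 1` real is specialised to integers `H ≥ 1` (equivalent: heights are integers, so
  `X(ℚ, T) = X(ℚ, ⌊T⌋)`); `N(Y, T) = #Y(ℚ, T)` is rendered, as in `WilkieConjecture.lean`, by
  `Set.Finite` together with `Set.ncard` of `ratPointsLE (transPart X) H`; Mathlib's
  `Height.mulHeight₁` on `ℚ` is `max(|a|, b)` in lowest terms (`Rat.mulHeight₁_eq_max`), i.e. the
  height of 1.3.
* Not here: the family versions 1.9/1.10 (uniformity of `c(Z, ε)` over the fibres of a definable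
  family, and the definable sub-family `W(Z, ε) ⊂ Z^alg`), nor the algebraic-points refinement of
  Pila 2009. The polylogarithmic strengthening for `ℝ_exp` is the tree's
  `BinyaminiNovikovZak2024_cor_1_rat` (`WilkieConjecture.lean`).
* Tree search (2026-08-15): `lean search --decl 'PilaWilkie|pila_wilkie|countingTheorem'` — no
  declaration; the only Pila–Wilkie vocabulary is `algPart/transPart/ratPointsLE` of
  `WilkieConjecture.lean`, reused here.

## References

* J. Pila, A. J. Wilkie, *The rational points of a definable set*, Duke Math. J. 133 (2006),
  591–616: 1.3, 1.5, 1.7, Thm. 1.8. [PilaWilkie2006]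
* A. Pillay, C. Steinhorn, *Definable sets in ordered structures I*, Trans. AMS 295 (1986),
  Def. 1.1. [PillaySteinhorn1986]
* G. Binyamini, D. Novikov, B. Zak, Ann. of Math. 199 (2024), §1.1. [BinyaminiNovikovZak2024]
-/

noncomputable section

open Set FirstOrder FirstOrder.Language

namespace Literature.ModelTheory.ExponentialFields

/-- **Pila–Wilkie 2006, Theorem 1.8 (the counting theorem, first version).** Printed: *"Let
`X ⊂ ℝⁿ` be a definable set* [in an o-minimal structure over the real field, 1.7]*, and `ε > 0`.
There is a constant `c(X, ε)` such that `N(X − X^alg, T) ≤ c(X, ε) T^ε`"*, where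
`N(Y, T) = #Y(ℚ, T)` counts the rational points of `Y` of height `≤ T` (1.3) and `X^alg` is the
union of the connected positive-dimensional semialgebraic subsets of `X` (1.5). Rendered: for
every first-order language `L` interpreted on `ℝ` such that the structure is o-minimal for the
usual order and the graphs of `+` and `·` are definable with parameters (an o-minimal expansion
of the real field), every `n`, every `X ⊆ ℝⁿ` definable with parameters and every `ε > 0`, there
is `c ∈ ℝ` such that for all integers `H ≥ 1` the set `(X ∖ X^alg)(ℚ, H)` is finite of cardinality
`≤ c · H^ε`. Grounds `Summit.Schanuel.Schanuel.Theses.MisiurewiczField.AddressSparsity`. Users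
take `(h : PilaWilkie2006_thm_1_8)`. [cite: PilaWilkie2006, Thm. 1.8 (with 1.3, 1.5, 1.7)] -/
def PilaWilkie2006_thm_1_8 : Prop :=
  ∀ (L : Language.{0, 0}) [L.Structure ℝ],
    L.IsOMinimal ℝ →
    (univ : Set ℝ).Definable L {v : Fin 3 → ℝ | v 0 + v 1 = v 2} →
    (univ : Set ℝ).Definable L {v : Fin 3 → ℝ | v 0 * v 1 = v 2} →
      ∀ (n : ℕ) (X : Set (Fin n → ℝ)), (univ : Set ℝ).Definable L X →
        ∀ ε : ℝ, 0 < ε → ∃ c : ℝ, ∀ H : ℕ, 1 ≤ H →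
          (ratPointsLE (transPart X) H).Finite ∧
            ((ratPointsLE (transPart X) H).ncard : ℝ) ≤ c * (H : ℝ) ^ ε

namespace PilaWilkie2006_thm_1_8

variable (h : PilaWilkie2006_thm_1_8)

include h

/-- Under Theorem 1.8: **integer points of the transcendental part are `O(H^ε)`.** For an
o-minimal expansion of the real field as above, `X ⊆ ℝⁿ` definable and `ε > 0`, there is `c` such
that for `H ≥ 1` the integer points `k ∈ ℤⁿ`, `|kᵢ| ≤ H`, lying in `X ∖ X^alg` are finite in
number, at most `c · H^ε` (they inject into `(X ∖ X^alg)(ℚ, H)`: an integer of absolute value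
`≤ H` is a rational of height `≤ H`, `intCast_mem_ratPointsLE`). This is the form used for
counting integer external addresses. [cite: PilaWilkie2006, Thm. 1.8] -/
theorem integerPoints (L : Language.{0, 0}) [L.Structure ℝ] (hO : L.IsOMinimal ℝ)
    (hadd : (univ : Set ℝ).Definable L {v : Fin 3 → ℝ | v 0 + v 1 = v 2})
    (hmul : (univ : Set ℝ).Definable L {v : Fin 3 → ℝ | v 0 * v 1 = v 2})
    (n : ℕ) (X : Set (Fin n → ℝ)) (hX : (univ : Set ℝ).Definable L X) (ε : ℝ) (hε : 0 < ε) :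
    ∃ c : ℝ, ∀ H : ℕ, 1 ≤ H →
      {k : Fin n → ℤ | (∀ i, |k i| ≤ H) ∧ (fun i ↦ (k i : ℝ)) ∈ transPart X}.Finite ∧
        ({k : Fin n → ℤ | (∀ i, |k i| ≤ H) ∧ (fun i ↦ (k i : ℝ)) ∈ transPart X}.ncard : ℝ) ≤
          c * (H : ℝ) ^ ε := by
  obtain ⟨c, hc⟩ := h L hO hadd hmul n X hX ε hε
  refine ⟨c, fun H hH ↦ ?_⟩
  obtain ⟨hfin, hcard⟩ := hc H hH
  set S : Set (Fin n → ℤ) := {k | (∀ i, |k i| ≤ H) ∧ (fun i ↦ (k i : ℝ)) ∈ transPart X} with hS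
  set ι : (Fin n → ℤ) → (Fin n → ℝ) := fun k i ↦ (k i : ℝ) with hι
  have hinj : Set.InjOn ι S := fun k _ k' _ hkk' ↦ funext fun i ↦ by
    have hi : (k i : ℝ) = (k' i : ℝ) := congrFun hkk' i
    exact_mod_cast hi
  have hmaps : Set.MapsTo ι S (ratPointsLE (transPart X) H) := fun k hk ↦
    intCast_mem_ratPointsLE hH hk.2 hk.1
  have hSfin : S.Finite := Set.Finite.of_injOn hmaps hinj hfin
  refine ⟨hSfin, ?_⟩
  have hle : S.ncard ≤ (ratPointsLE (transPart X) H).ncard :=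
    Set.ncard_le_ncard_of_injOn ι hmaps hinj hfin
  calc (S.ncard : ℝ) ≤ (ratPointsLE (transPart X) H).ncard := by exact_mod_cast hle
    _ ≤ c * (H : ℝ) ^ ε := hcard

end PilaWilkie2006_thm_1_8

end Literature.ModelTheory.ExponentialFields

end
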